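import Summits.CriticalPhenomena.PercolationContinuityZ3.Theorems.PercNearOneGluingNoHeavyLowerTailPinnedCA
import HarnessLib

/-!
# `NoHeavyLowerTail` (stmt-CriticalPhenomena-4575) — the reliability gain through a vertex set is bounded by the two
# pinned attachments

Support file (`--supports stmt-CriticalPhenomena-4575`), lemma factory #7 (`prim-lf-7`, k-cluster conditional
association, gen 6).  No definitions, no named facts, no sorries.  Corollary of `PinnedCA.pinned_negCorrelation`
(`…NoHeavyLowerTailPinnedCA`).

For a vertex set `S` and distinct `p, b ∉ S` write `D_S = (openConnIn Sᶜ p b)ᶜ` ("no open `p–b` path avoiding `S`") and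
`{x ↔ S} = ⋃_{s∈S} {x ↔ s}`.  The GAIN of `p` through `S` is `μ(p ↔ b) − μ(p ↔ b in Sᶜ) = μ({p ↔ b} ∩ D_S)` — in
Kozma–Nitzan's notation `P_G(p ↔ b) − P_{G∖S}(p ↔ b)` (arXiv:2401.12397, §3.2: the goodness correction terms
`P_{G∖W}(a ↔ b)`; hub blocks of the depth-two observers).

* `PinnedCA.exists_reachable_mem_of_not_openConnIn` — `p ↔ b` but not inside `Sᶜ` ⇒ `p ↔ S` (first visit of `S`).
* `PinnedCA.gain_mul_le` — **`(μ(p ↔ b) − μ(p ↔ b in Sᶜ)) · μ(D_S) ≤ μ(D_S ∩ {p ↔ S}) · μ(D_S ∩ {b ↔ S})`**: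
  `{p ↔ b} ∖ {p ↔ b in Sᶜ} ⊆ D_S ∩ {p ↔ S} ∩ {b ↔ S}` and pinned conditional association.  In conditional form (when
  `μ(D_S) > 0`): gain ≤ `P(p ↔ S | D_S) · μ(D_S ∩ {b ↔ S})` ≤ `P(p ↔ S | D_S) · P(b ↔ S | D_S) · μ(D_S)`.
[cite: VandenbergHaggstromKahn2005, Thm. 1.4 (p. 7)] [cite: KozmaNitzan2024, §3.2 (pp. 12–14)]
-/

namespace Summit.CriticalPhenomena.PercolationContinuityZ3.Theorems

open MeasureTheory Set Literature.Probability.LatticeModels Literature.Probability.Percolation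
open scoped Classical
open KNPreFKG

noncomputable section

namespace PinnedCA

variable {V : Type*}

/-- If `p ↔ b` but not inside `Sᶜ`, then `p` is joined to a vertex of `S` (walk to the first visit of `S`). [folklore] -/
theorem exists_reachable_mem_of_not_openConnIn {ω : BondConfig V} (S : Set V) {p b : V}
    (h : (openGraph ω).Reachable p b) (hn : ω ∉ openConnIn Sᶜ p b) :
    ∃ s ∈ S, (openGraph ω).Reachable p s := by
  have key : ∀ (u : V) (q : (openGraph ω).Walk u b),
      (∃ s ∈ S, (openGraph ω).Reachable u s) ∨ ω ∈ openConnIn Sᶜ u b := by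
    intro u q
    clear h hn
    induction q with
    | nil =>
      rename_i u
      by_cases hu : u ∈ S
      · exact Or.inl ⟨u, hu, SimpleGraph.Reachable.refl _⟩
      · exact Or.inr (openConnIn_rfl (show u ∈ Sᶜ from hu) ω)
    | cons hadj q ih =>
      rename_i u u₁ v
      by_cases hu : u ∈ S
      · exact Or.inl ⟨u, hu, SimpleGraph.Reachable.refl _⟩
      · rcases ih with ⟨s, hs, hr⟩ | hr
        · exact Or.inl ⟨s, hs, hadj.reachable.trans hr⟩
        · exact Or.inr (openConnIn_trans
            (openConnIn_of_adj (show u ∈ Sᶜ from hu) hr.1 hadj) hr)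
  obtain ⟨q⟩ := h
  rcases key p q with h1 | h1
  · exact h1
  · exact absurd h1 hn

section Gain

variable [Fintype V]

/-- **The reliability gain through a vertex set.**  For a vertex set `S` and distinct `p, b ∉ S`, with
`D_S = (openConnIn Sᶜ p b)ᶜ`:
`(μ(p ↔ b) − μ(p ↔ b in Sᶜ)) · μ(D_S) ≤ μ(D_S ∩ {p ↔ S}) · μ(D_S ∩ {b ↔ S})`.
[cite: VandenbergHaggstromKahn2005, Thm. 1.4 (p. 7)] -/
theorem gain_mul_le (w : Sym2 V → unitInterval) (S : Set V) {p b : V}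
    (hp : p ∉ S) (hb : b ∉ S) (hpb : p ≠ b) :
    ((prodBernoulli w).real (openConn p b) - (prodBernoulli w).real (openConnIn Sᶜ p b)) *
        (prodBernoulli w).real (openConnIn Sᶜ p b)ᶜ ≤
      (prodBernoulli w).real ((openConnIn Sᶜ p b)ᶜ ∩ ⋃ s ∈ S, openConn p s) *
        (prodBernoulli w).real ((openConnIn Sᶜ p b)ᶜ ∩ ⋃ s ∈ S, openConn b s) := by
  classical
  have main := pinned_negCorrelation w S hp hb hpb
  set μ := prodBernoulli w with hμ
  have hmeas : ∀ Z : Set (BondConfig V), MeasurableSet Z := fun _ => MeasurableSet.of_discrete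
  set D : Set (BondConfig V) := (openConnIn Sᶜ p b)ᶜ with hD
  set Ap : Set (BondConfig V) := ⋃ s ∈ S, openConn p s with hAp
  set Ab : Set (BondConfig V) := ⋃ s ∈ S, openConn b s with hAb
  -- `μ(p ↔ b) − μ(p ↔ b in Sᶜ) = μ({p ↔ b} ∩ D_S)`
  have hsub : (openConnIn Sᶜ p b : Set (BondConfig V)) ⊆ openConn p b :=
    fun ω hω => reachable_of_openConnIn hω
  have hsplit := measureReal_inter_add_sdiff (μ := μ) (s := (openConn p b : Set (BondConfig V)))
    (hmeas (openConnIn Sᶜ p b))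
  rw [inter_eq_self_of_subset_right hsub] at hsplit
  have hdiff : μ.real (openConn p b) - μ.real (openConnIn Sᶜ p b) = μ.real (openConn p b ∩ D) := by
    rw [hD, ← Set.sdiff_eq]
    linarith
  -- `{p ↔ b} ∩ D_S ⊆ D_S ∩ ({p ↔ S} ∩ {b ↔ S})`
  have hincl : openConn p b ∩ D ⊆ D ∩ (Ap ∩ Ab) := by
    rintro ω ⟨hω, hωD⟩
    have h1 := exists_reachable_mem_of_not_openConnIn S hω hωD
    have hωD' : ω ∉ openConnIn Sᶜ b p := fun h => hωD ⟨h.2.1, h.1, h.2.2.symm⟩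
    have h2 := exists_reachable_mem_of_not_openConnIn S (SimpleGraph.Reachable.symm hω) hωD'
    refine ⟨hωD, ?_, ?_⟩
    · rw [hAp]
      simp only [mem_iUnion, exists_prop]
      exact h1
    · rw [hAb]
      simp only [mem_iUnion, exists_prop]
      exact h2
  have hle : μ.real (openConn p b ∩ D) ≤ μ.real (D ∩ (Ap ∩ Ab)) := measureReal_mono hincl
  have hDnn : 0 ≤ μ.real D := measureReal_nonneg
  rw [hdiff]
  calc μ.real (openConn p b ∩ D) * μ.real D ≤ μ.real (D ∩ (Ap ∩ Ab)) * μ.real D :=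
        mul_le_mul_of_nonneg_right hle hDnn
    _ = μ.real D * μ.real (D ∩ (Ap ∩ Ab)) := mul_comm _ _
    _ ≤ μ.real (D ∩ Ap) * μ.real (D ∩ Ab) := main

end Gain

end PinnedCA

end

end Summit.CriticalPhenomena.PercolationContinuityZ3.Theorems
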